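import Mathlib
import Summits.Schanuel.Schanuel.Theorems.RigidCoreMinimalCounterexampleInAclProdExpDegenerate

/-!
# Super-polynomial blow-up of `2 cos y₀` along the mates — crux stmt-Schanuel-0969

Route `RigidCore`, crux (S*) `MinimalCounterexampleInAcl` (item stmt-Schanuel-0969), line
`kernel-arithmetic-selection` (skeleton gen 19, lead prover-line-stmt-Schanuel-0969-c6-0), registered stub
`stub_cosDegenerate` (the parameter-free twisted gadget `Φ(y) = e^{iy₀} + e^{-iy₀} = 2 cos y₀` of the two-sided
selection core), landed `--supports stmt-Schanuel-0969`.

For a rank-2 first failure `x` with `x₀` transcendental, along the mates `y` of `x` the escape of `y₀` is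
VERTICAL: `|Re y₀| = O(log ‖y₀‖)` (two-sided polynomial size of `e^{y₀}`, `stub_mateCoeffGrowth`), hence
`|Im y₀| ≥ ‖y₀‖ − |Re y₀| → ∞` and `‖2 cos y₀‖ ≥ e^{|Im y₀|} − 1` blows up faster than every power of `‖y₀‖`:
for every `M` there is `R` with `‖Φ(y)‖⁻¹ (1 + ‖y₀‖)^M ≤ 1` for every mate `y` with `‖y₀‖ ≥ R`.

Proof.  (a) `stub_mateCoeffGrowth` at `F = Y₀` (value `e^{y₀}` at `(y, e^y)`, non-zero at `x`) gives
`C⁻¹ (1+r)^{-D} ≤ ‖e^{y₀}‖ ≤ C (1+r)^D` for `r = ‖y₀‖ ≥ R₁`, i.e. `|Re y₀| ≤ L := log (C (1+r)^D)`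
(`abs_re_le_log_of_two_sided`).  (b) `|Im y₀| ≥ r − L` (`Complex.norm_le_abs_re_add_abs_im`).
(c) `‖e^{iy₀}‖ = e^{−Im y₀}`, `‖e^{−iy₀}‖ = e^{Im y₀}`, so `e^{|Im y₀|} ≤ ‖Φ(y)‖ + 1` (reverse triangle
inequality, `exp_abs_im_le_norm_add_one`).  (d) `2 C (1+r)^{D+M} ≤ eʳ` for `r` large
(`exists_mul_one_add_pow_le_exp`, from `eˣ/xⁿ → ∞`), whence `(1+r)^M + 1 ≤ e^{r − L} ≤ e^{|Im y₀|} ≤ ‖Φ‖ + 1`.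

Pure real/complex analysis over the landed toolkit (Theorems/…MateCoeffGrowth, …ProdExpDegenerate); Mathlib
otherwise.
-/

noncomputable section

set_option linter.dupNamespace false

namespace Summit.Schanuel.Schanuel.Cruxes.MinimalCounterexampleInAcl.KernelArithmeticSelection

/-! ## Real/complex-analysis lemmas -/

/-- Exp beats every polynomial: for every `C` and `N` there is `R` with `C (1+r)^N ≤ eʳ` for all `r ≥ R`
(from `eˣ / xᴺ → ∞` along `x = 1 + r`). -/
theorem exists_mul_one_add_pow_le_exp (C : ℝ) (N : ℕ) :
    ∃ R : ℝ, ∀ r : ℝ, R ≤ r → C * (1 + r) ^ N ≤ Real.exp r := by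
  have h1 : Filter.Tendsto (fun r : ℝ => 1 + r) Filter.atTop Filter.atTop :=
    Filter.tendsto_atTop_add_const_left _ _ Filter.tendsto_id
  obtain ⟨R, hR⟩ := Filter.eventually_atTop.1
    (((Real.tendsto_exp_div_pow_atTop N).comp h1).eventually_ge_atTop (C * Real.exp 1))
  refine ⟨max R 0, fun r hr => ?_⟩
  have hr0 : 0 ≤ r := le_trans (le_max_right _ _) hr
  have h := hR r (le_trans (le_max_left _ _) hr)
  have hP : 0 < (1 + r) ^ N := pow_pos (by linarith) N
  rw [Function.comp_apply, le_div_iff₀ hP, Real.exp_add] at h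
  have h' : Real.exp 1 * (C * (1 + r) ^ N) ≤ Real.exp 1 * Real.exp r := by linarith
  exact le_of_mul_le_mul_left h' (Real.exp_pos 1)

/-- The twisted gadget dominates `e^{|Im w|} − 1`: `e^{|Im w|} ≤ ‖e^{iw} + e^{−iw}‖ + 1`
(`‖e^{iw}‖ = e^{−Im w}`, `‖e^{−iw}‖ = e^{Im w}`, reverse triangle inequality). -/
theorem exp_abs_im_le_norm_add_one (w : ℂ) :
    Real.exp |w.im| ≤ ‖Complex.exp (Complex.I * w) + Complex.exp (-(Complex.I * w))‖ + 1 := by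
  have h1 : ‖Complex.exp (Complex.I * w)‖ = Real.exp (-w.im) := by
    rw [Complex.norm_exp, Complex.I_mul_re]
  have h2 : ‖Complex.exp (-(Complex.I * w))‖ = Real.exp w.im := by
    rw [Complex.norm_exp, Complex.neg_re, Complex.I_mul_re, neg_neg]
  have ha := norm_le_add_norm_add (Complex.exp (Complex.I * w)) (Complex.exp (-(Complex.I * w)))
  have hb := norm_le_add_norm_add' (Complex.exp (Complex.I * w)) (Complex.exp (-(Complex.I * w)))
  rw [h1, h2] at ha hb
  rcases le_or_gt 0 w.im with h0 | h0
  · rw [abs_of_nonneg h0]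
    have h3 : Real.exp (-w.im) ≤ 1 := Real.exp_le_one_iff.2 (by linarith)
    linarith
  · rw [abs_of_neg h0]
    have h3 : Real.exp w.im ≤ 1 := Real.exp_le_one_iff.2 h0.le
    linarith

/-! ## The registered stub -/

/-- **Registered stub `stub_cosDegenerate` (PROVED) — the parameter-free twisted gadget
`Φ(y) = e^{iy₀} + e^{−iy₀} = 2 cos y₀` BLOWS UP super-polynomially along the far mates of a rank-2 first
failure.**  For `x ∈ firstFailures 2` with `x₀` transcendental and every `M : ℕ` there is `R` such that every
mate `y` of `x` with `‖y₀‖ ≥ R` satisfies `‖e^{iy₀} + e^{−iy₀}‖⁻¹ (1 + ‖y₀‖)^M ≤ 1`: the escape of `y₀` is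
vertical (`|Re y₀| ≤ log (C (1 + ‖y₀‖)^D)` by the two-sided polynomial size of `e^{y₀}`, `stub_mateCoeffGrowth`),
so `|Im y₀| ≥ ‖y₀‖ − O(log ‖y₀‖)` and `‖Φ(y)‖ ≥ e^{|Im y₀|} − 1`. -/
theorem stub_cosDegenerate : ∀ (x : Fin 2 → ℂ), x ∈ Summit.Schanuel.Schanuel.Cruxes.MinimalCounterexampleInAcl.KernelArithmeticSelection.firstFailures 2 → Transcendental ℚ (x 0) → ∀ M : ℕ, ∃ R : ℝ, ∀ y : Fin 2 → ℂ, y ∈ Summit.Schanuel.Schanuel.Cruxes.MinimalCounterexampleInAcl.KernelArithmeticSelection.locusMates x → R ≤ ‖y 0‖ → ‖Complex.exp (Complex.I * y 0) + Complex.exp (-(Complex.I * y 0))‖⁻¹ * (1 + ‖y 0‖) ^ M ≤ 1 := by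
  intro x hx hx0 M
  have htr : Algebra.trdeg ℚ ↥(IntermediateField.adjoin ℚ (Set.range x ∪ Set.range (Complex.exp ∘ x))) <
      (2 : Cardinal) := by
    exact_mod_cast hx.2.1
  -- (a) two-sided polynomial size of `e^{y 0}` in terms of `‖y 0‖`
  obtain ⟨Ra, Ca, Da, hCa, ha⟩ := stub_mateCoeffGrowth x htr hx0 (MvPolynomial.X (Sum.inr 0))
  -- (d) the exp-beats-polynomial threshold
  obtain ⟨Re, hRe⟩ := exists_mul_one_add_pow_le_exp (2 * Ca) (Da + M)
  refine ⟨max Ra Re, fun y hy hR => ?_⟩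
  have hmem : y ∈ locusPts x := hy.2
  have hRa : Ra ≤ ‖y 0‖ := le_trans (le_max_left _ _) hR
  have hRe' : Re ≤ ‖y 0‖ := le_trans (le_max_right _ _) hR
  have hr0 : 0 ≤ ‖y 0‖ := norm_nonneg _
  have hP : 0 < 1 + ‖y 0‖ := by linarith
  have hPD : 0 < (1 + ‖y 0‖) ^ Da := pow_pos hP Da
  have hA : 0 < Ca * (1 + ‖y 0‖) ^ Da := mul_pos hCa hPD
  -- (a) `|Re (y 0)| ≤ L := log (Ca (1 + ‖y 0‖) ^ Da)`
  obtain ⟨ha1, ha2⟩ := ha y hmem hRa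
  simp only [MvPolynomial.aeval_X, Sum.elim_inr, Function.comp_apply] at ha1 ha2
  have hreL := abs_re_le_log_of_two_sided hCa hPD ha1 (ha2 (Complex.exp_ne_zero _))
  -- (b) `‖y 0‖ - L ≤ |Im (y 0)|`
  have him : ‖y 0‖ - Real.log (Ca * (1 + ‖y 0‖) ^ Da) ≤ |(y 0).im| := by
    have h := Complex.norm_le_abs_re_add_abs_im (y 0)
    linarith
  -- (d) `(1 + ‖y 0‖) ^ M + 1 ≤ exp (‖y 0‖ - L)`
  have hPM : 1 ≤ (1 + ‖y 0‖) ^ M := one_le_pow₀ (by linarith)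
  have hkey : (1 + ‖y 0‖) ^ M + 1 ≤ Real.exp (‖y 0‖ - Real.log (Ca * (1 + ‖y 0‖) ^ Da)) := by
    rw [Real.exp_sub, Real.exp_log hA, le_div_iff₀ hA]
    calc ((1 + ‖y 0‖) ^ M + 1) * (Ca * (1 + ‖y 0‖) ^ Da)
        ≤ 2 * (1 + ‖y 0‖) ^ M * (Ca * (1 + ‖y 0‖) ^ Da) :=
          mul_le_mul_of_nonneg_right (by linarith) hA.le
      _ = 2 * Ca * (1 + ‖y 0‖) ^ (Da + M) := by rw [pow_add]; ring
      _ ≤ Real.exp ‖y 0‖ := hRe _ hRe'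
  -- (c) `exp |Im (y 0)| ≤ ‖Φ y‖ + 1`
  have hmono : Real.exp (‖y 0‖ - Real.log (Ca * (1 + ‖y 0‖) ^ Da)) ≤ Real.exp |(y 0).im| :=
    Real.exp_le_exp.2 him
  have hgad := exp_abs_im_le_norm_add_one (y 0)
  have hΦ : (1 + ‖y 0‖) ^ M ≤ ‖Complex.exp (Complex.I * y 0) + Complex.exp (-(Complex.I * y 0))‖ := by
    linarith
  have hΦpos : 0 < ‖Complex.exp (Complex.I * y 0) + Complex.exp (-(Complex.I * y 0))‖ := by
    linarith
  rw [inv_mul_le_iff₀ hΦpos, mul_one]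
  exact hΦ

end Summit.Schanuel.Schanuel.Cruxes.MinimalCounterexampleInAcl.KernelArithmeticSelection

end
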